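import Summits.CriticalPhenomena.PercolationContinuityZ3.Theorems.PercNearOneGluingNoHeavyLowerTailCornerRealizers
import Literature.Probability.Percolation.TripodExchange
import HarnessLib

/-!
# `NoHeavyLowerTail` (stmt-CriticalPhenomena-4575) — corner programme, layer 3:
# EVENT GLUING HOLDS TO LEADING ORDER AT THE RELIABLE CORNER, for every finite weighted graph and EVERY relay set

The crux's ladder rests on the event-gluing inequality EG: `P(o ↔ A, o ↮ b) ≤ max_{a ∈ A} P(a ↮ b)` (EG ⇒
AdditiveGluing ⇒ Kozma–Nitzan Conjecture 3 ≡ `NearOneGluing`; proved in the tree for `|A| ≤ 2` via the tripod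
exchange C⁺, open for `|A| ≥ 3`).  This file proves EG for ALL `|A|` in the reliable corner
`w_e = 1 − ε λ_e` (`ε → 0⁺`, support `E`, rates `λ > 0`) of an arbitrary finite weighted graph, in two forms:

* `Corner.leading_exit_le` — the combinatorial theorem on leading coefficients (memo A5-COUPLING-gen2 §4.6): if every
  relay's disconnection event `{a ↮ b}` has order `≥ m` on the support, then the order-`m` coefficient of the exit
  event `X = {o ↔ A} ∩ {o ↮ b}` is at most that of `{a ↮ b}` for SOME relay `a ∈ A`;
* `Corner.eventGluing_corner` — the measure statement: for every nonempty `A` there is ONE relay `a ∈ A` with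
  `P_ε(X) ≤ (1 + γ)·P_ε(a ↮ b)` for every `γ > 0` and all small `ε > 0`.

Proof (all `|A|` at once): order-`m` realizers of `X` are unions over relays `a` of the families
`F_a = {S : order-m realizer of {a ↮ b} whose a-cluster contains o}`; the sub/posimodular cut calculus
(`…CornerCuts`, `…CutAntichain.cut_inter₃_eq_zero`) forbids three pairwise ⊆-incomparable `F_a` (no
three-antichain), so `⋃_a F_a = F_{t₁} ∪ F_{t₂}`; one class is trivial, and two incomparable classes are settled by
the tripod exchange C⁺ (`Literature…tripodExchange`, = 4 × BHK Thm 1.5) read at leading order through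
`Corner.leading_mul_le_of_real_mul_le`, the identification of the four tripod coefficients with sub-families of the
realizers using `Corner.reachable_target_of_min_realizer` (both sides of a minimum realizer are connected).
No sorries; standard axioms. Nothing here asserts the crux: the corner is one regime (per-graph asymptotics), the
crux is uniform in the graph.
-/

noncomputable section

namespace Summit.CriticalPhenomena.PercolationContinuityZ3.Theorems

open MeasureTheory Filter Topology Finset
open Literature.Probability.LatticeModels Literature.Probability.Percolation

namespace Corner

open scoped Classical

variable {V : Type*} [Fintype V] [DecidableEq V]

/-! ### The corner event-gluing theorem on leading coefficients -/

/-- **Corner event gluing, coefficient form (all `|A|`).** If every relay's disconnection event `{a ↮ b}` has order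
`≥ m` on the support, then for some relay `a ∈ A` the order-`m` coefficient of the exit event
`{o ↔ A} ∩ {o ↮ b}` is at most that of `{a ↮ b}`. [folklore] (new here; memo A5-COUPLING-gen2 §4.6) -/
theorem leading_exit_le (E : Finset (Sym2 V)) (lam : Sym2 V → ℝ) (hlam : ∀ e ∈ E, 0 ≤ lam e)
    (A : Finset V) (hA : A.Nonempty) (o b : V) (m : ℕ)
    (hm : ∀ a ∈ A, ∀ T ∈ E.powerset, (↑T : Set (Sym2 V)) ∈ (openConn a b)ᶜ → m ≤ (E \ T).card) :
    ∃ a ∈ A, leading E lam (exitEvent A o b) m ≤ leading E lam (openConn a b)ᶜ m := by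
  obtain ⟨t₁, ht₁, t₂, ht₂, hcov⟩ := exists_two_cover A (upFam E m o b) hA
    (fun t₁ h₁ t₂ h₂ t₃ h₃ => upFam_no_three_antichain E m o b (hm t₁ h₁) (hm t₂ h₂) (hm t₃ h₃))
  have hX : realizers E (exitEvent A o b) m = upFam E m o b t₁ ∪ upFam E m o b t₂ := by
    ext S
    rw [mem_realizers_exit_iff, Finset.mem_union]
    constructor
    · rintro ⟨a, ha, hS⟩
      rcases hcov a ha with h | h
      · exact Or.inl (h hS)
      · exact Or.inr (h hS)
    · rintro (h | h)
      · exact ⟨t₁, ht₁, h⟩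
      · exact ⟨t₂, ht₂, h⟩
  rw [leading_eq_famWeight, hX]
  by_cases h21 : upFam E m o b t₂ ⊆ upFam E m o b t₁
  · refine ⟨t₁, ht₁, ?_⟩
    rw [Finset.union_eq_left.2 h21, leading_eq_famWeight]
    exact famWeight_mono hlam (upFam_subset E m o b t₁)
  by_cases h12 : upFam E m o b t₁ ⊆ upFam E m o b t₂
  · refine ⟨t₂, ht₂, ?_⟩
    rw [Finset.union_eq_right.2 h12, leading_eq_famWeight]
    exact famWeight_mono hlam (upFam_subset E m o b t₂)
  -- incomparable classes: m ≥ 1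
  have hm1 : 1 ≤ m := by
    rcases Nat.eq_zero_or_pos m with h0 | hpos
    · exfalso
      subst h0
      obtain ⟨S, hS₁, hS₁'⟩ := Finset.not_subset.1 h12
      obtain ⟨S', hS₂, hS₂'⟩ := Finset.not_subset.1 h21
      rw [eq_of_mem_upFam_zero hS₁] at hS₁
      rw [eq_of_mem_upFam_zero hS₂] at hS₂'
      exact hS₂' hS₁
    · exact hpos
  set F₁ := upFam E m o b t₁ with hF₁
  set F₂ := upFam E m o b t₂ with hF₂
  set R₁ := realizers E (openConn t₁ b)ᶜ m
  set R₂ := realizers E (openConn t₂ b)ᶜ m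
  set p₁ := famWeight E lam (F₂ \ F₁)
  set p₂ := famWeight E lam (F₁ \ F₂)
  set q₁ := famWeight E lam (R₁ \ F₁)
  set q₂ := famWeight E lam (R₂ \ F₂)
  have hW₁ : famWeight E lam (F₁ ∪ F₂) = famWeight E lam F₁ + p₁ := famWeight_union_eq F₁ F₂
  have hW₂ : famWeight E lam (F₁ ∪ F₂) = famWeight E lam F₂ + p₂ := by
    rw [Finset.union_comm]; exact famWeight_union_eq F₂ F₁
  have hD₁ : leading E lam (openConn t₁ b)ᶜ m = famWeight E lam F₁ + q₁ := by
    rw [leading_eq_famWeight]; exact famWeight_eq_add_sdiff (upFam_subset E m o b t₁)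
  have hD₂ : leading E lam (openConn t₂ b)ᶜ m = famWeight E lam F₂ + q₂ := by
    rw [leading_eq_famWeight]; exact famWeight_eq_add_sdiff (upFam_subset E m o b t₂)
  rcases le_or_gt (famWeight E lam (F₁ ∪ F₂)) (leading E lam (openConn t₁ b)ᶜ m) with hle₁ | hlt₁
  · exact ⟨t₁, ht₁, hle₁⟩
  rcases le_or_gt (famWeight E lam (F₁ ∪ F₂)) (leading E lam (openConn t₂ b)ᶜ m) with hle₂ | hlt₂
  · exact ⟨t₂, ht₂, hle₂⟩
  exfalso
  have hpq₁ : q₁ < p₁ := by linarith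
  have hpq₂ : q₂ < p₂ := by linarith
  have hq₁ : 0 ≤ q₁ := famWeight_nonneg hlam _
  have hq₂ : 0 ≤ q₂ := famWeight_nonneg hlam _
  -- the four tripod events and their coefficients
  set T₁ : Set (Set (Sym2 V)) := openConn o t₂ ∩ openConn t₁ b ∩ (openConn t₂ t₁)ᶜ
  set T₂ : Set (Set (Sym2 V)) := openConn o t₁ ∩ openConn t₂ b ∩ (openConn t₂ t₁)ᶜ
  set T₃ : Set (Set (Sym2 V)) := openConn o t₂ ∩ openConn t₂ b ∩ (openConn t₂ t₁)ᶜ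
  set T₄ : Set (Set (Sym2 V)) := openConn o t₁ ∩ openConn t₁ b ∩ (openConn t₂ t₁)ᶜ
  have hp₁ : p₁ ≤ leading E lam T₁ m := by
    rw [leading_eq_famWeight]
    exact famWeight_mono hlam fun S hS =>
      mem_realizers_tripod_of_mem_sdiff hm1 (hm t₁ ht₁) (hm t₂ ht₂) (Finset.mem_sdiff.1 hS).1 (Finset.mem_sdiff.1 hS).2
  have hp₂ : p₂ ≤ leading E lam T₂ m := by
    rw [leading_eq_famWeight]
    refine famWeight_mono hlam fun S hS => ?_
    have h := mem_realizers_tripod_of_mem_sdiff hm1 (hm t₂ ht₂) (hm t₁ ht₁)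
      (Finset.mem_sdiff.1 hS).1 (Finset.mem_sdiff.1 hS).2
    -- `{t₁ ↮ t₂}` versus `{t₂ ↮ t₁}`
    obtain ⟨hSE, hT, hcard⟩ := mem_realizers.1 h
    refine mem_realizers.2 ⟨hSE, ?_, hcard⟩
    simp only [Set.mem_inter_iff, Set.mem_compl_iff, openConn, Set.mem_setOf_eq] at hT ⊢
    exact ⟨hT.1, fun h' => hT.2 h'.symm⟩
  have hq₁' : leading E lam T₃ m ≤ q₁ := by
    rw [leading_eq_famWeight]
    exact famWeight_mono hlam (realizers_tripod_subset_sdiff E m o b t₁ t₂)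
  have hq₂' : leading E lam T₄ m ≤ q₂ := by
    rw [leading_eq_famWeight]
    refine famWeight_mono hlam fun S hS => ?_
    have hS' : S ∈ realizers E (openConn o t₁ ∩ openConn t₁ b ∩ (openConn t₁ t₂)ᶜ) m := by
      obtain ⟨hSE, hT, hcard⟩ := mem_realizers.1 hS
      refine mem_realizers.2 ⟨hSE, ?_, hcard⟩
      simp only [Set.mem_inter_iff, Set.mem_compl_iff, openConn, Set.mem_setOf_eq] at hT ⊢
      exact ⟨hT.1, fun h' => hT.2 h'.symm⟩
    exact realizers_tripod_subset_sdiff E m o b t₂ t₁ hS'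
  -- C⁺ at the corner
  have hC : leading E lam T₁ m * leading E lam T₂ m ≤ leading E lam T₃ m * leading E lam T₄ m := by
    refine leading_mul_le_of_real_mul_le E lam hlam T₁ T₂ T₃ T₄ m ?_ ?_ ?_ ?_
      (Filter.Eventually.of_forall fun ε => tripodExchange (cornerWeight E lam ε) o t₂ t₁ b)
    · intro S hS hD
      have h := order_tripod_left (o := o) (hm t₂ ht₂) S hS hD
      convert h using 2
      ext e; simp only [Finset.mem_sdiff]
    · intro S hS hD
      have hD' : (↑S : Set (Sym2 V)) ∈ openConn o t₁ ∩ openConn t₂ b ∩ (openConn t₁ t₂)ᶜ := by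
        simp only [Set.mem_inter_iff, Set.mem_compl_iff, openConn, Set.mem_setOf_eq] at hD ⊢
        exact ⟨hD.1, fun h' => hD.2 h'.symm⟩
      have h := order_tripod_left (o := o) (hm t₁ ht₁) S hS hD'
      convert h using 2
      ext e; simp only [Finset.mem_sdiff]
    · intro S hS hD
      have h := order_tripod_right (o := o) (hm t₁ ht₁) S hS hD
      convert h using 2
      ext e; simp only [Finset.mem_sdiff]
    · intro S hS hD
      have hD' : (↑S : Set (Sym2 V)) ∈ openConn o t₁ ∩ openConn t₁ b ∩ (openConn t₁ t₂)ᶜ := by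
        simp only [Set.mem_inter_iff, Set.mem_compl_iff, openConn, Set.mem_setOf_eq] at hD ⊢
        exact ⟨hD.1, fun h' => hD.2 h'.symm⟩
      have h := order_tripod_right (o := o) (hm t₂ ht₂) S hS hD'
      convert h using 2
      ext e; simp only [Finset.mem_sdiff]
  have hL₁ : 0 ≤ leading E lam T₁ m := leading_nonneg E lam hlam T₁ m
  have hL₄ : 0 ≤ leading E lam T₄ m := leading_nonneg E lam hlam T₄ m
  have hp₂nn : 0 ≤ p₂ := famWeight_nonneg hlam _
  have h1 : p₁ * p₂ ≤ leading E lam T₁ m * leading E lam T₂ m := mul_le_mul hp₁ hp₂ hp₂nn hL₁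
  have h2 : leading E lam T₃ m * leading E lam T₄ m ≤ q₁ * q₂ := mul_le_mul hq₁' hq₂' hL₄ hq₁
  have h3 : q₁ * q₂ < p₁ * p₂ := mul_lt_mul'' hpq₁ hpq₂ hq₁ hq₂
  linarith

/-! ### The measure statement: event gluing at the reliable corner -/

omit [Fintype V] in
/-- A realizer of positive weight makes the leading coefficient of its order positive (`λ > 0` on `E`). [folklore] -/
theorem leading_pos_of_mem_realizers {E : Finset (Sym2 V)} {lam : Sym2 V → ℝ} (hlam : ∀ e ∈ E, 0 < lam e)
    {D : Set (Set (Sym2 V))} {m : ℕ} {S : Finset (Sym2 V)} (hS : S ∈ realizers E D m) :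
    0 < leading E lam D m := by
  rw [leading_eq_famWeight]
  have hle : famWeight E lam {S} ≤ famWeight E lam (realizers E D m) :=
    famWeight_mono (fun e he => (hlam e he).le) (Finset.singleton_subset_iff.2 hS)
  refine lt_of_lt_of_le ?_ hle
  rw [famWeight, Finset.sum_singleton]
  exact Finset.prod_pos fun e he => hlam e (Finset.mem_sdiff.1 he).1

omit [Fintype V] in
/-- If no realizer of `D` has exactly `m` closed pairs, the order-`m` coefficient vanishes. [folklore] -/
theorem leading_eq_zero_of_forall {E : Finset (Sym2 V)} {lam : Sym2 V → ℝ} {D : Set (Set (Sym2 V))} {m : ℕ}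
    (h : ∀ S ∈ E.powerset, (↑S : Set (Sym2 V)) ∈ D → (E \ S).card ≠ m) : leading E lam D m = 0 := by
  rw [leading_eq_famWeight, famWeight]
  refine Finset.sum_eq_zero fun S hS => ?_
  obtain ⟨hSE, hD, hcard⟩ := mem_realizers.1 hS
  exact absurd hcard (h S (Finset.mem_powerset.2 hSE) hD)

/-- **Event gluing at the reliable corner, for every relay set** (coupling seat, corner programme): on any finite
vertex type with support `E` and rates `λ > 0`, along `w_e = 1 − ε λ_e` there is ONE relay `a ∈ A` such that for
every `γ > 0`, eventually as `ε → 0⁺`, `P_ε(o ↔ A, o ↮ b) ≤ (1 + γ)·P_ε(a ↮ b)`. [folklore] (new here) -/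
theorem eventGluing_corner (E : Finset (Sym2 V)) (lam : Sym2 V → ℝ) (hlam : ∀ e ∈ E, 0 < lam e)
    (A : Finset V) (hA : A.Nonempty) (o b : V) :
    ∃ a ∈ A, ∀ γ : ℝ, 0 < γ → ∀ᶠ ε in 𝓝[>] (0 : ℝ),
      (prodBernoulli (cornerWeight E lam ε)).real (exitEvent A o b) ≤
        (1 + γ) * (prodBernoulli (cornerWeight E lam ε)).real (openConn a b)ᶜ := by
  have hlam' : ∀ e ∈ E, 0 ≤ lam e := fun e he => (hlam e he).le
  -- bridging the classical `DecidableEq` of layer 1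
  have bridge : ∀ {D : Set (Set (Sym2 V))} {m : ℕ},
      (∀ S ∈ E.powerset, (↑S : Set (Sym2 V)) ∈ D → m ≤ (E \ S).card) →
      ∀ S ∈ E.powerset, (↑S : Set (Sym2 V)) ∈ D →
        m ≤ (@SDiff.sdiff (Finset (Sym2 V)) (@Finset.instSDiff (Sym2 V) fun a b => Classical.propDecidable (a = b))
          E S).card := by
    intro D m h S hS hD
    have h' := h S hS hD
    convert h' using 2
    ext e; simp only [Finset.mem_sdiff]
  by_cases hX : (E.powerset.filter fun S : Finset (Sym2 V) => (↑S : Set (Sym2 V)) ∈ exitEvent A o b).Nonempty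
  · -- minimal order of the exit event
    obtain ⟨S₀, hS₀, hmin⟩ := Finset.exists_min_image _ (fun S => (E \ S).card) hX
    rw [Finset.mem_filter] at hS₀
    set m := (E \ S₀).card with hm
    have hXord : ∀ S ∈ E.powerset, (↑S : Set (Sym2 V)) ∈ exitEvent A o b → m ≤ (E \ S).card :=
      fun S hS hD => hmin S (Finset.mem_filter.2 ⟨hS, hD⟩)
    have hXpos : 0 < leading E lam (exitEvent A o b) m :=
      leading_pos_of_mem_realizers hlam (mem_realizers.2 ⟨Finset.mem_powerset.1 hS₀.1, hS₀.2, rfl⟩)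
    by_cases hlow : ∃ a ∈ A, ∃ S ∈ E.powerset, (↑S : Set (Sym2 V)) ∈ (openConn a b)ᶜ ∧ (E \ S).card < m
    · -- a strictly less reliable relay dominates outright
      obtain ⟨a, ha, S₁, hS₁, hS₁D, hlt⟩ := hlow
      have hne : (E.powerset.filter fun S : Finset (Sym2 V) => (↑S : Set (Sym2 V)) ∈ (openConn a b)ᶜ).Nonempty :=
        ⟨S₁, Finset.mem_filter.2 ⟨hS₁, hS₁D⟩⟩
      obtain ⟨S₂, hS₂, hmin₂⟩ := Finset.exists_min_image _ (fun S => (E \ S).card) hne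
      rw [Finset.mem_filter] at hS₂
      set m' := (E \ S₂).card with hm'
      have hm'lt : m' < m := lt_of_le_of_lt (hmin₂ S₁ (Finset.mem_filter.2 ⟨hS₁, hS₁D⟩)) hlt
      have h₂ : ∀ S ∈ E.powerset, (↑S : Set (Sym2 V)) ∈ (openConn a b)ᶜ → m' ≤ (E \ S).card :=
        fun S hS hD => hmin₂ S (Finset.mem_filter.2 ⟨hS, hD⟩)
      have h₁ : ∀ S ∈ E.powerset, (↑S : Set (Sym2 V)) ∈ exitEvent A o b → m' ≤ (E \ S).card :=
        fun S hS hD => hm'lt.le.trans (hXord S hS hD)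
      have hpos : 0 < leading E lam (openConn a b)ᶜ m' :=
        leading_pos_of_mem_realizers hlam (mem_realizers.2 ⟨Finset.mem_powerset.1 hS₂.1, hS₂.2, rfl⟩)
      have hzero : leading E lam (exitEvent A o b) m' = 0 :=
        leading_eq_zero_of_forall fun S hS hD => ne_of_gt (hm'lt.trans_le (hXord S hS hD))
      refine ⟨a, ha, fun γ hγ => ?_⟩
      exact eventually_real_le_mul_of_leading_le E lam hlam' _ _ m' (bridge h₁) (bridge h₂) hpos
        (by rw [hzero]; exact hpos.le) hγ
    · -- all relays at least as reliable as the exit event: the coefficient theorem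
      have hm_all : ∀ a ∈ A, ∀ T ∈ E.powerset, (↑T : Set (Sym2 V)) ∈ (openConn a b)ᶜ → m ≤ (E \ T).card := by
        intro a ha T hT hD
        by_contra hlt
        exact hlow ⟨a, ha, T, hT, hD, not_le.mp hlt⟩
      obtain ⟨a, ha, hle⟩ := leading_exit_le E lam hlam' A hA o b m hm_all
      refine ⟨a, ha, fun γ hγ => ?_⟩
      exact eventually_real_le_mul_of_leading_le E lam hlam' _ _ m (bridge hXord) (bridge (hm_all a ha))
        (hXpos.trans_le hle) hle hγ
  · -- the exit event has no realizer on the support: its probability vanishes near the corner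
    obtain ⟨a, ha⟩ := hA
    refine ⟨a, ha, fun γ hγ => ?_⟩
    filter_upwards [eventually_small E lam hlam'] with ε hε
    have h0 : (prodBernoulli (cornerWeight E lam ε)).real (exitEvent A o b) = 0 := by
      rw [real_eq_sum_powerset E lam ε hε.2]
      refine Finset.sum_eq_zero fun S hS => ?_
      rw [if_neg]
      exact fun hD => hX ⟨S, Finset.mem_filter.2 ⟨hS, hD⟩⟩
    rw [h0]
    exact mul_nonneg (by linarith) measureReal_nonneg

/-- **Additive gluing at the reliable corner** (the shape of crux `AdditiveGluing` / Kozma–Nitzan Conjecture 3, per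
graph, to leading order): there is ONE relay `a ∈ A` with `P_ε(o ↮ b) ≤ P_ε(o ↮ A) + (1 + γ)·P_ε(a ↮ b)` for every
`γ > 0` and all small `ε > 0`. Union bound `{o ↮ b} ⊆ {o ↮ A} ∪ X` on top of `eventGluing_corner`. [folklore] -/
theorem additiveGluing_corner (E : Finset (Sym2 V)) (lam : Sym2 V → ℝ) (hlam : ∀ e ∈ E, 0 < lam e)
    (A : Finset V) (hA : A.Nonempty) (o b : V) :
    ∃ a ∈ A, ∀ γ : ℝ, 0 < γ → ∀ᶠ ε in 𝓝[>] (0 : ℝ),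
      (prodBernoulli (cornerWeight E lam ε)).real (openConn o b)ᶜ ≤
        (prodBernoulli (cornerWeight E lam ε)).real (⋃ a ∈ A, openConn o a)ᶜ +
          (1 + γ) * (prodBernoulli (cornerWeight E lam ε)).real (openConn a b)ᶜ := by
  obtain ⟨a, ha, h⟩ := eventGluing_corner E lam hlam A hA o b
  refine ⟨a, ha, fun γ hγ => ?_⟩
  filter_upwards [h γ hγ] with ε hε
  set μ := prodBernoulli (cornerWeight E lam ε)
  have hsub : (openConn o b : Set (BondConfig V))ᶜ ⊆ (⋃ a ∈ A, openConn o a)ᶜ ∪ exitEvent A o b := by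
    intro ω hω
    by_cases hA' : ω ∈ ⋃ a ∈ A, openConn o a
    · exact Or.inr ⟨hA', hω⟩
    · exact Or.inl hA'
  calc μ.real (openConn o b)ᶜ ≤ μ.real ((⋃ a ∈ A, openConn o a)ᶜ ∪ exitEvent A o b) :=
        measureReal_mono hsub
    _ ≤ μ.real (⋃ a ∈ A, openConn o a)ᶜ + μ.real (exitEvent A o b) := measureReal_union_le _ _
    _ ≤ μ.real (⋃ a ∈ A, openConn o a)ᶜ + (1 + γ) * μ.real (openConn a b)ᶜ := by linarith

/-! ### The uniform corner: `bondPercolation G p`, `p → 1⁻` -/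

/-- At density `p = 1 − ε` (clamped), Bernoulli bond percolation on `G` is the corner measure with unit rates on the
edge set of `G`. [folklore] -/
theorem bondPercolation_eq_cornerWeight (G : SimpleGraph V) (ε : ℝ) :
    bondPercolation G (Set.projIcc (0 : ℝ) 1 zero_le_one (1 - ε)) =
      prodBernoulli (cornerWeight G.edgeFinset (fun _ => (1 : ℝ)) ε) := by
  rw [bondPercolation, ← prodBernoulli_indicator_holds G.edgeSet]
  congr 1
  funext e
  by_cases he : e ∈ G.edgeSet
  · have he' : e ∈ G.edgeFinset := SimpleGraph.mem_edgeFinset.2 he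
    simp only [cornerWeight, if_pos he, if_pos he', mul_one]
  · have he' : e ∉ G.edgeFinset := fun h => he (SimpleGraph.mem_edgeFinset.1 h)
    simp only [cornerWeight, if_neg he, if_neg he']

/-- **Event gluing near density one, for every relay set** (uniform corner of `eventGluing_corner`): for Bernoulli
bond percolation on any finite simple graph `G` at density `1 − ε`, there is ONE relay `a ∈ A` with
`P_{1−ε}(o ↔ A, o ↮ b) ≤ (1 + γ)·P_{1−ε}(a ↮ b)` for every `γ > 0` and all small `ε > 0`. [folklore] (new here) -/
theorem eventGluing_uniform_corner (G : SimpleGraph V) (A : Finset V) (hA : A.Nonempty) (o b : V) :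
    ∃ a ∈ A, ∀ γ : ℝ, 0 < γ → ∀ᶠ ε in 𝓝[>] (0 : ℝ),
      (bondPercolation G (Set.projIcc (0 : ℝ) 1 zero_le_one (1 - ε))).real (exitEvent A o b) ≤
        (1 + γ) * (bondPercolation G (Set.projIcc (0 : ℝ) 1 zero_le_one (1 - ε))).real (openConn a b)ᶜ := by
  obtain ⟨a, ha, h⟩ := eventGluing_corner G.edgeFinset (fun _ => (1 : ℝ)) (fun _ _ => one_pos) A hA o b
  refine ⟨a, ha, fun γ hγ => ?_⟩
  filter_upwards [h γ hγ] with ε hε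
  rwa [bondPercolation_eq_cornerWeight]

end Corner

end Summit.CriticalPhenomena.PercolationContinuityZ3.Theorems

end
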